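import Mathlib
import Summits.CriticalPhenomena.PercolationContinuityZ3.Theorems.PercNearOneGluingNoHeavyLowerTailFatMinorityEdgeLemma
import Summits.CriticalPhenomena.PercolationContinuityZ3.Theorems.PercNearOneGluingNoHeavyLowerTailFatMinoritySingletonStep
import Summits.CriticalPhenomena.PercolationContinuityZ3.Theorems.PercNearOneGluingNoHeavyLowerTailFatMinorityThresholdBookkeeping
import HarnessLib

/-!
# `NoHeavyLowerTail` (stmt-CriticalPhenomena-4575), line fat-minority-linear — the (UT4, QUT4) INDUCTION ASSEMBLED:
# the up-set star inequality for every number of ports, modulo its Case-II instances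
# (route task `nh-dp-fatminority`, gen 11; PROOF-INDUCTION-modulo-C2.md)

`μ = prodBernoulli w` on the pairs of `Fin n`; `o` an observer whose positive-weight pairs go to the port set `A` (`o ∉ A`, no loop);
`b` the target; for an up-set `𝒰 ⊆ 𝒫(A)` with `∅ ∉ 𝒰`, `U = {ω | ∃ B ∈ 𝒰, ∀ u ∈ B, s(o,u) ∈ ω}`; `c ≠ o` a vertex; a threshold
`t ≥ 0` is ADMISSIBLE if `μ(c↔b) − μ(v↔b) ≤ t` for every port `v ∈ A`.

TARGET(w, A): for all such `𝒰, c` and admissible `t`:  `μ({c↔b} ∩ U) − μ({o↔b} ∩ U) ≤ t · μ(U)`.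
(With `t = (μ(c↔b) − min_v μ(v↔b))⁺` this is UT4 — Kozma–Nitzan's Theorem 4 on every up-set, `t = 0` — and QUT4, the
negative side of the star inequality SQ of the notes.)

* `upsetStar_port_step`: the step of the induction at a port `z` that is a singleton of `𝒰` OR at which Case I holds
  (`μ₁(z↔b) ≤ μ₁(c↔b)`, `μ₁ = μ_{w[s(o,z)↦1]}`), from TARGET one port down (ports `A ∖ {z}`, law `μ_{w[s(o,z)↦0]}`):
  slack edge lemma (`slackEdgeLemma`, T4) for `E ≥ 0` and for the threshold bookkeeping (`threshold_bookkeeping_posPart`, T5),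
  then `upsetStar_singleton_step` (B2) / `upsetStar_caseI_step` (Case I).
* `upsetStar_target_of_caseII`: **if TARGET holds in every Case-II instance** (no singleton in `𝒰`, `μ₁(c↔b) < μ₁(z↔b)` at every
  port `z`) of every weighting on `Fin n` with observer `o` and target `b`, **then TARGET holds for every weighting, every
  port set, every up-set, every `c` and every admissible `t`** — induction on `|A|`.
The Case-II instances are exactly what the one-port certificates address (`upsetStar_of_onePortCertificate`,
`upsetStar_of_hybridCertificate`; conjecture (C2∃)/(H) of the notes).  With `rt4_of_ut4` (THEOREM C) the `t = 0` case then gives the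
restricted Theorem 4 for every decreasing cluster event.  No definitions.
-/

namespace Summit.CriticalPhenomena.PercolationContinuityZ3.Theorems

open MeasureTheory Set
open Literature.Probability.LatticeModels (prodBernoulli)
open Literature.Probability.Percolation

noncomputable section
open scoped Classical

variable {n : ℕ}

/-- Under `w[s(o,z) ↦ 0]` the star up-event of `𝒰` agrees almost surely with that of the members of `𝒰` avoiding `z`.
[folklore] -/
theorem real_inter_starUpEvent_update_zero (w : Sym2 (Fin n) → unitInterval) (o z : Fin n)
    (𝒰 : Finset (Finset (Fin n))) (X : Set (BondConfig (Fin n))) :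
    (prodBernoulli (Function.update w s(o, z) 0)).real (X ∩ {ω | ∃ B ∈ 𝒰, ∀ u ∈ B, s(o, u) ∈ ω}) =
      (prodBernoulli (Function.update w s(o, z) 0)).real
        (X ∩ {ω | ∃ B ∈ 𝒰.filter (fun B => z ∉ B), ∀ u ∈ B, s(o, u) ∈ ω}) := by
  rw [real_update_zero_eq_inter_edgeClosed w s(o, z) (X ∩ {ω | ∃ B ∈ 𝒰, ∀ u ∈ B, s(o, u) ∈ ω}),
    real_update_zero_eq_inter_edgeClosed w s(o, z)
      (X ∩ {ω | ∃ B ∈ 𝒰.filter (fun B => z ∉ B), ∀ u ∈ B, s(o, u) ∈ ω})]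
  congr 1
  ext ω
  simp only [mem_inter_iff, mem_setOf_eq, Finset.mem_filter]
  constructor
  · rintro ⟨⟨hX, B, hB, hop⟩, he⟩
    exact ⟨⟨hX, B, ⟨hB, fun hz => he (hop z hz)⟩, hop⟩, he⟩
  · rintro ⟨⟨hX, B, ⟨hB, -⟩, hop⟩, he⟩
    exact ⟨⟨hX, B, hB, hop⟩, he⟩

/-- **The induction step at a port `z` which is a singleton of `𝒰` or at which Case I holds.**  See the module
docstring. [cite: KozmaNitzan2024, Lemma 3 p. 6, Lemma 4 p. 9, Lemma 5 p. 13; VandenbergHaggstromKahn2005, Thm. 1.4/1.5 (p. 7); assembly: route notes gen 9 (PROOF-INDUCTION-modulo-C2)] -/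
theorem upsetStar_port_step (w : Sym2 (Fin n) → unitInterval) (A : Finset (Fin n)) (o z c b : Fin n)
    (hoA : o ∉ A) (hzA : z ∈ A) (hco : c ≠ o)
    (hiso : ∀ u, u ≠ o → u ∉ A → w s(o, u) = 0) (hloop : w s(o, o) = 0)
    (𝒰 : Finset (Finset (Fin n))) (h𝒰A : 𝒰 ⊆ A.powerset) (h0 : ∅ ∉ 𝒰)
    (hup : ∀ B ∈ 𝒰, ∀ B' ∈ A.powerset, B ⊆ B' → B' ∈ 𝒰)
    (t : ℝ) (ht0 : 0 ≤ t)
    (hgap : ∀ v ∈ A, (prodBernoulli w).real (openConn c b) - (prodBernoulli w).real (openConn v b) ≤ t)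
    (hcase : ({z} : Finset (Fin n)) ∈ 𝒰 ∨
      (prodBernoulli (Function.update w s(o, z) 1)).real (openConn z b) ≤
        (prodBernoulli (Function.update w s(o, z) 1)).real (openConn c b))
    (hIH : ∀ c' : Fin n, c' ≠ o → ∀ t' : ℝ, 0 ≤ t' →
      (∀ v ∈ A.erase z, (prodBernoulli (Function.update w s(o, z) 0)).real (openConn c' b) -
          (prodBernoulli (Function.update w s(o, z) 0)).real (openConn v b) ≤ t') →
      ∀ 𝒰' : Finset (Finset (Fin n)), 𝒰' ⊆ (A.erase z).powerset → ∅ ∉ 𝒰' →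
        (∀ B ∈ 𝒰', ∀ B' ∈ (A.erase z).powerset, B ⊆ B' → B' ∈ 𝒰') →
        (prodBernoulli (Function.update w s(o, z) 0)).real
              (openConn c' b ∩ {ω | ∃ B ∈ 𝒰', ∀ u ∈ B, s(o, u) ∈ ω}) -
            (prodBernoulli (Function.update w s(o, z) 0)).real
              (openConn o b ∩ {ω | ∃ B ∈ 𝒰', ∀ u ∈ B, s(o, u) ∈ ω}) ≤
          t' * (prodBernoulli (Function.update w s(o, z) 0)).real {ω | ∃ B ∈ 𝒰', ∀ u ∈ B, s(o, u) ∈ ω}) :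
    (prodBernoulli w).real (openConn c b ∩ {ω | ∃ B ∈ 𝒰, ∀ u ∈ B, s(o, u) ∈ ω}) -
        (prodBernoulli w).real (openConn o b ∩ {ω | ∃ B ∈ 𝒰, ∀ u ∈ B, s(o, u) ∈ ω}) ≤
      t * (prodBernoulli w).real {ω | ∃ B ∈ 𝒰, ∀ u ∈ B, s(o, u) ∈ ω} := by
  have hzo : z ≠ o := fun h => hoA (h ▸ hzA)
  have hp0 : 0 ≤ (w s(o, z) : ℝ) := (w s(o, z)).2.1
  have hp1 : (w s(o, z) : ℝ) ≤ 1 := (w s(o, z)).2.2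
  -- the least reliable port
  obtain ⟨v₀, hv₀A, hv₀⟩ := Finset.exists_min_image A (fun v => (prodBernoulli w).real (openConn v b)) ⟨z, hzA⟩
  set m : ℝ := (prodBernoulli w).real (openConn v₀ b) with hm
  have hmle : ∀ v ∈ A, m ≤ (prodBernoulli w).real (openConn v b) := fun v hv => hv₀ v hv
  -- one-bond decompositions
  have hbond : ∀ x : Fin n, (prodBernoulli w).real (openConn x b) =
      (1 - (w s(o, z) : ℝ)) * (prodBernoulli (Function.update w s(o, z) 0)).real (openConn x b) +
        (w s(o, z) : ℝ) * (prodBernoulli (Function.update w s(o, z) 1)).real (openConn x b) :=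
    fun x => prodBernoulli_real_oneBond (determinedBy_univ_fin _) w (Finset.mem_univ s(o, z))
  -- the slack edge lemma at `z` (T4), from TARGET one port down with `c' = z`
  have hedge : ∀ c' : Fin n, c' ≠ o →
      (1 - (w s(o, z) : ℝ)) *
          (((prodBernoulli (Function.update w s(o, z) 1)).real (openConn c' b) -
              (prodBernoulli (Function.update w s(o, z) 0)).real (openConn c' b)) -
            ((prodBernoulli (Function.update w s(o, z) 1)).real (openConn z b) -
              (prodBernoulli (Function.update w s(o, z) 0)).real (openConn z b))) ≤
        (prodBernoulli w).real (openConn z b) - m :=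
    fun c' hc' => slackEdgeLemma w A o z b c' hoA hzA hc' hiso hloop m hmle (hIH z hzo)
  -- `E ≥ 0`
  set E : ℝ := ((prodBernoulli w).real (openConn z b) - m) +
      (1 - (w s(o, z) : ℝ)) *
        (((prodBernoulli (Function.update w s(o, z) 1)).real (openConn z b) -
            (prodBernoulli (Function.update w s(o, z) 0)).real (openConn z b)) -
          ((prodBernoulli (Function.update w s(o, z) 1)).real (openConn c b) -
            (prodBernoulli (Function.update w s(o, z) 0)).real (openConn c b))) with hEdef
  have hE : 0 ≤ E := by have h := hedge c hco; simp only [hEdef]; linarith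
  -- `μ₁(c↔b) − μ₁(z↔b) ≤ t − E`
  have hA_hi : (prodBernoulli (Function.update w s(o, z) 1)).real (openConn c b) -
      (prodBernoulli (Function.update w s(o, z) 1)).real (openConn z b) ≤ t - E := by
    have h1 := hbond c
    have h2 := hbond z
    have h3 := hgap v₀ hv₀A
    simp only [hEdef]
    nlinarith [h1, h2, h3, hp0, hp1]
  -- the threshold one port down (T5)
  obtain ⟨t₀, ht₀0, hdom, ht₀⟩ : ∃ t₀ : ℝ, 0 ≤ t₀ ∧
      (∀ v ∈ A.erase z, (prodBernoulli (Function.update w s(o, z) 0)).real (openConn c b) -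
          (prodBernoulli (Function.update w s(o, z) 0)).real (openConn v b) ≤ t₀) ∧
      (1 - (w s(o, z) : ℝ)) * t₀ ≤ (1 - (w s(o, z) : ℝ)) * t + (w s(o, z) : ℝ) * E := by
    rcases (A.erase z).eq_empty_or_nonempty with hemp | hne
    · refine ⟨0, le_refl _, fun v hv => ?_, ?_⟩
      · rw [hemp] at hv; exact (Finset.notMem_empty v hv).elim
      · have : 0 ≤ (1 - (w s(o, z) : ℝ)) * t := mul_nonneg (by linarith) ht0
        nlinarith [mul_nonneg hp0 hE]
    · obtain ⟨vs, hvs, hvsmax⟩ := Finset.exists_max_image (A.erase z)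
        (fun v => (prodBernoulli (Function.update w s(o, z) 0)).real (openConn c b) -
          (prodBernoulli (Function.update w s(o, z) 0)).real (openConn v b)) hne
      obtain ⟨hvsz, hvsA⟩ := Finset.mem_erase.1 hvs
      have hvso : vs ≠ o := fun h => hoA (h ▸ hvsA)
      refine ⟨max 0 ((prodBernoulli (Function.update w s(o, z) 0)).real (openConn c b) -
          (prodBernoulli (Function.update w s(o, z) 0)).real (openConn vs b)), le_max_left _ _,
        fun v hv => (hvsmax v hv).trans (le_max_right _ _), ?_⟩
      have hbook := threshold_bookkeeping_posPart hp0 hp1 (hbond c) (hbond vs) (hmle vs hvsA)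
        (hedge vs hvso) hE
      have hmax : max 0 ((prodBernoulli w).real (openConn c b) - m) ≤ t :=
        max_le ht0 (hgap v₀ hv₀A)
      have h1p : 0 ≤ 1 - (w s(o, z) : ℝ) := by linarith
      have := mul_le_mul_of_nonneg_left hmax h1p
      simp only [hEdef]
      linarith
  -- TARGET one port down for the members of `𝒰` avoiding `z`
  set 𝒰₀ : Finset (Finset (Fin n)) := 𝒰.filter (fun B => z ∉ B) with h𝒰₀
  have h𝒰₀A : 𝒰₀ ⊆ (A.erase z).powerset := by
    intro B hB
    obtain ⟨hB𝒰, hzB⟩ := Finset.mem_filter.1 hB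
    rw [Finset.mem_powerset]
    intro u hu
    exact Finset.mem_erase.2 ⟨fun h => hzB (h ▸ hu), Finset.mem_powerset.1 (h𝒰A hB𝒰) hu⟩
  have h𝒰₀0 : ∅ ∉ 𝒰₀ := fun h => h0 (Finset.mem_filter.1 h).1
  have h𝒰₀up : ∀ B ∈ 𝒰₀, ∀ B' ∈ (A.erase z).powerset, B ⊆ B' → B' ∈ 𝒰₀ := by
    intro B hB B' hB' hBB'
    obtain ⟨hB𝒰, -⟩ := Finset.mem_filter.1 hB
    have hB'A : B' ∈ A.powerset :=
      Finset.mem_powerset.2 ((Finset.mem_powerset.1 hB').trans (Finset.erase_subset _ _))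
    refine Finset.mem_filter.2 ⟨hup B hB𝒰 B' hB'A hBB', fun hz => ?_⟩
    exact (Finset.mem_erase.1 (Finset.mem_powerset.1 hB' hz)).1 rfl
  have hIHU : (prodBernoulli (Function.update w s(o, z) 0)).real
          (openConn c b ∩ {ω | ∃ B ∈ 𝒰, ∀ u ∈ B, s(o, u) ∈ ω}) -
        (prodBernoulli (Function.update w s(o, z) 0)).real
          (openConn o b ∩ {ω | ∃ B ∈ 𝒰, ∀ u ∈ B, s(o, u) ∈ ω}) ≤
      t₀ * (prodBernoulli (Function.update w s(o, z) 0)).real {ω | ∃ B ∈ 𝒰, ∀ u ∈ B, s(o, u) ∈ ω} := by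
    have h := hIH c hco t₀ ht₀0 hdom 𝒰₀ h𝒰₀A h𝒰₀0 h𝒰₀up
    have hU : (prodBernoulli (Function.update w s(o, z) 0)).real {ω | ∃ B ∈ 𝒰, ∀ u ∈ B, s(o, u) ∈ ω} =
        (prodBernoulli (Function.update w s(o, z) 0)).real {ω | ∃ B ∈ 𝒰₀, ∀ u ∈ B, s(o, u) ∈ ω} := by
      have h' := real_inter_starUpEvent_update_zero w o z 𝒰 univ
      simpa only [univ_inter] using h'
    rw [real_inter_starUpEvent_update_zero w o z 𝒰 (openConn c b),
      real_inter_starUpEvent_update_zero w o z 𝒰 (openConn o b), hU]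
    exact h
  -- conclude by the singleton step (B2) or the Case-I step
  rcases hcase with hsing | hI
  · exact upsetStar_singleton_step w A o z c b hoA hzA 𝒰 hsing t E t₀ hE hA_hi ht₀ hIHU
  · have hA_lo : 0 ≤ (prodBernoulli (Function.update w s(o, z) 1)).real (openConn c b) -
        (prodBernoulli (Function.update w s(o, z) 1)).real (openConn z b) := by linarith
    exact upsetStar_caseI_step w A o z c b hoA hzA 𝒰 h𝒰A t E t₀ hE hA_lo hA_hi ht₀ hIHU

/-- **The (UT4, QUT4) induction, assembled.**  Fix the observer `o` and the target `b`.  If the up-set star inequality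
TARGET holds in every CASE-II instance on `Fin n` (no singleton of `𝒰` is a member, and `μ_{w[s(o,z)↦1]}(c↔b) < μ_{w[s(o,z)↦1]}(z↔b)`
at every port `z`), then TARGET holds for every weighting, every port set `A ∌ o` (observer isolated off `A`, no loop), every
up-set `𝒰 ∌ ∅`, every `c ≠ o` and every admissible threshold `t`.  Induction on `|A|` with `upsetStar_port_step`.
[cite: KozmaNitzan2024, Thm. 4 p. 13, Lemma 3 p. 6, Lemma 4 p. 9, Lemma 5 p. 13; VandenbergHaggstromKahn2005, Thm. 1.4/1.5 (p. 7); assembly: route notes gen 9/11 (PROOF-INDUCTION-modulo-C2)] -/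
theorem upsetStar_target_of_caseII (o b : Fin n)
    (hC2 : ∀ (w : Sym2 (Fin n) → unitInterval) (A : Finset (Fin n)) (c : Fin n)
      (𝒰 : Finset (Finset (Fin n))) (t : ℝ),
      o ∉ A → (∀ u, u ≠ o → u ∉ A → w s(o, u) = 0) → w s(o, o) = 0 → c ≠ o →
      𝒰 ⊆ A.powerset → ∅ ∉ 𝒰 → (∀ B ∈ 𝒰, ∀ B' ∈ A.powerset, B ⊆ B' → B' ∈ 𝒰) →
      (∀ z ∈ A, ({z} : Finset (Fin n)) ∉ 𝒰) →
      (∀ z ∈ A, (prodBernoulli (Function.update w s(o, z) 1)).real (openConn c b) <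
        (prodBernoulli (Function.update w s(o, z) 1)).real (openConn z b)) →
      0 ≤ t → (∀ v ∈ A, (prodBernoulli w).real (openConn c b) - (prodBernoulli w).real (openConn v b) ≤ t) →
      (prodBernoulli w).real (openConn c b ∩ {ω | ∃ B ∈ 𝒰, ∀ u ∈ B, s(o, u) ∈ ω}) -
          (prodBernoulli w).real (openConn o b ∩ {ω | ∃ B ∈ 𝒰, ∀ u ∈ B, s(o, u) ∈ ω}) ≤
        t * (prodBernoulli w).real {ω | ∃ B ∈ 𝒰, ∀ u ∈ B, s(o, u) ∈ ω})
    (k : ℕ) :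
    ∀ (w : Sym2 (Fin n) → unitInterval) (A : Finset (Fin n)), A.card ≤ k → o ∉ A →
      (∀ u, u ≠ o → u ∉ A → w s(o, u) = 0) → w s(o, o) = 0 →
      ∀ 𝒰 : Finset (Finset (Fin n)), 𝒰 ⊆ A.powerset → ∅ ∉ 𝒰 →
        (∀ B ∈ 𝒰, ∀ B' ∈ A.powerset, B ⊆ B' → B' ∈ 𝒰) →
        ∀ c : Fin n, c ≠ o → ∀ t : ℝ, 0 ≤ t →
          (∀ v ∈ A, (prodBernoulli w).real (openConn c b) - (prodBernoulli w).real (openConn v b) ≤ t) →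
          (prodBernoulli w).real (openConn c b ∩ {ω | ∃ B ∈ 𝒰, ∀ u ∈ B, s(o, u) ∈ ω}) -
              (prodBernoulli w).real (openConn o b ∩ {ω | ∃ B ∈ 𝒰, ∀ u ∈ B, s(o, u) ∈ ω}) ≤
            t * (prodBernoulli w).real {ω | ∃ B ∈ 𝒰, ∀ u ∈ B, s(o, u) ∈ ω} := by
  induction k with
  | zero =>
    intro w A hA hoA hiso hloop 𝒰 h𝒰A h0 hup c hco t ht0 hgap
    have hAe : A = ∅ := Finset.card_eq_zero.1 (Nat.le_zero.1 hA)
    have h𝒰e : 𝒰 = ∅ := by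
      refine Finset.eq_empty_of_forall_notMem fun B hB => h0 ?_
      have hBA := Finset.mem_powerset.1 (h𝒰A hB)
      rw [hAe, Finset.subset_empty] at hBA
      exact hBA ▸ hB
    have hU : {ω : BondConfig (Fin n) | ∃ B ∈ 𝒰, ∀ u ∈ B, s(o, u) ∈ ω} = ∅ := by
      ext ω; simp [h𝒰e]
    simp [hU]
  | succ k ih =>
    intro w A hA hoA hiso hloop 𝒰 h𝒰A h0 hup c hco t ht0 hgap
    -- TARGET one port down, at any port `z ∈ A`, from the induction hypothesis
    have hIH' : ∀ z ∈ A, ∀ c' : Fin n, c' ≠ o → ∀ t' : ℝ, 0 ≤ t' →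
        (∀ v ∈ A.erase z, (prodBernoulli (Function.update w s(o, z) 0)).real (openConn c' b) -
            (prodBernoulli (Function.update w s(o, z) 0)).real (openConn v b) ≤ t') →
        ∀ 𝒰' : Finset (Finset (Fin n)), 𝒰' ⊆ (A.erase z).powerset → ∅ ∉ 𝒰' →
          (∀ B ∈ 𝒰', ∀ B' ∈ (A.erase z).powerset, B ⊆ B' → B' ∈ 𝒰') →
          (prodBernoulli (Function.update w s(o, z) 0)).real
                (openConn c' b ∩ {ω | ∃ B ∈ 𝒰', ∀ u ∈ B, s(o, u) ∈ ω}) -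
              (prodBernoulli (Function.update w s(o, z) 0)).real
                (openConn o b ∩ {ω | ∃ B ∈ 𝒰', ∀ u ∈ B, s(o, u) ∈ ω}) ≤
            t' * (prodBernoulli (Function.update w s(o, z) 0)).real {ω | ∃ B ∈ 𝒰', ∀ u ∈ B, s(o, u) ∈ ω} := by
      intro z hzA c' hc' t' ht' hdom 𝒰' h𝒰' h0' hup'
      have hzo : z ≠ o := fun h => hoA (h ▸ hzA)
      have hcard : (A.erase z).card ≤ k := by
        rw [Finset.card_erase_of_mem hzA]; omega
      have hoA' : o ∉ A.erase z := fun h => hoA (Finset.mem_of_mem_erase h)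
      have hiso' : ∀ u, u ≠ o → u ∉ A.erase z → Function.update w s(o, z) 0 s(o, u) = 0 := by
        intro u huo hu
        by_cases huz : u = z
        · subst huz; simp only [Function.update_self]
        · have hne : s(o, u) ≠ s(o, z) := fun h => huz (Sym2.congr_right.mp h)
          simp only [Function.update_of_ne hne]
          exact hiso u huo (fun huA => hu (Finset.mem_erase.2 ⟨huz, huA⟩))
      have hloop' : Function.update w s(o, z) 0 s(o, o) = 0 := by
        have hne : s(o, o) ≠ s(o, z) := fun h => hzo (Sym2.congr_right.mp h).symm
        simp only [Function.update_of_ne hne]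
        exact hloop
      exact ih (Function.update w s(o, z) 0) (A.erase z) hcard hoA' hiso' hloop' 𝒰' h𝒰' h0' hup' c' hc' t' ht' hdom
    by_cases hsing : ∃ z ∈ A, ({z} : Finset (Fin n)) ∈ 𝒰
    · obtain ⟨z, hzA, hz⟩ := hsing
      exact upsetStar_port_step w A o z c b hoA hzA hco hiso hloop 𝒰 h𝒰A h0 hup t ht0 hgap (Or.inl hz) (hIH' z hzA)
    · push Not at hsing
      by_cases hI : ∃ z ∈ A, (prodBernoulli (Function.update w s(o, z) 1)).real (openConn z b) ≤
          (prodBernoulli (Function.update w s(o, z) 1)).real (openConn c b)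
      · obtain ⟨z, hzA, hz⟩ := hI
        exact upsetStar_port_step w A o z c b hoA hzA hco hiso hloop 𝒰 h𝒰A h0 hup t ht0 hgap (Or.inr hz) (hIH' z hzA)
      · push Not at hI
        exact hC2 w A c 𝒰 t hoA hiso hloop hco h𝒰A h0 hup hsing hI ht0 hgap

end

end Summit.CriticalPhenomena.PercolationContinuityZ3.Theorems
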